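import Literature.NumberTheory.Transcendental.BrownLevelOneProofs
import Literature.Analysis.SpecialFunctions.ArcsinPowerSeries
import Mathlib.Analysis.Normed.Group.Tannery
import HarnessLib

/-!
# Brown, *Mixed Tate motives over ℤ* — Zagier's theorem for all weights, I: tail sums and the
# series `ζ(2ᵇ 3 2ᵃ) = ∑ₙ E_b(n) n⁻³ Z_n(2ᵃ)`

Sibling proof file in the cone of the named fact
`Literature.NumberTheory.Transcendental.hoffmanSpan_eq_mzvSpace` (Brown 2012, Theorem 1.1). Brown's
Theorem 4.1 is Zagier's evaluation of `H(a,b) = ζ(2,…,2,3,2,…,2)` (Zagier 2012, Theorem 1); the tree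
proves it in weights `≤ 9` (`BrownZagierFormulaLowWeightProofs`) and reduces the level-one case of
Brown's theorem to it (`Brown2012.multipleZeta_odd_mem_hoffmanSpan_of_zagier`). This file and its
sequels (`BrownZagierHoffmanIntegral`, `BrownZagierFormulaProofs`) prove Zagier's theorem for ALL
`a, b`, following the elementary proof of Lai–Lupu–Orr [LaiLupuOrr2026, §3].

Here: the bookkeeping of nested sums behind [LaiLupuOrr2026, Theorem 3.2, last display] —
`∑ₙ n⁻³ (∑_{n₁<⋯<n_a<n} ∏ nᵢ⁻²)(∑_{n<m₁<⋯<m_b} ∏ mⱼ⁻²) = H(a,b)` — in the tree's conventions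
(`multipleZeta` sums over DEcreasing indices, so Zagier's/Brown's `ζ(2ᵃ 3 2ᵇ)` is
`multipleZeta (replicate b 2 ++ 3 :: replicate a 2)`, cf. `BrownLevelOneProofs`):

* `MZV.tailTrunc b N n = ∑_{N > m₁ > ⋯ > m_b > n} ∏ mⱼ⁻²` (finite tails, split-largest recursion) and
  `MZV.tailSum b n = E_b(n) = ∑_{m₁ > ⋯ > m_b > n} ∏ mⱼ⁻²` (the tail as a series), with
  `tendsto_tailTrunc` (`tailTrunc b N n → E_b(n)`), the recursion
  `E_{b+1}(n) = E_{b+1}(n+1) + (n+1)⁻² E_b(n+1)` (`tailSum_succ_eq`), `E_b(0) = ζ({2}ᵇ) = π²ᵇ/(2b+1)!`;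
* `arcsinNestedSum_eq_mzvTrunc` : the coefficients `e_a(n)` of the `arcsin` power series
  (`Literature.Analysis.SpecialFunctions.ArcsinPowerSeries`) are the truncated sums `Z_n({2}ᵃ)`;
* `mzvTrunc_replicate_two_append` : `Z_N(2ᵇ ++ c :: u) = ∑_{n<N} tailTrunc b N n · n⁻ᶜ Z_n(u)`;
* `multipleZeta_twos_three_twos_eq_tsum` : **`ζ(2ᵇ 3 2ᵃ) = ∑ₙ E_b(n) n⁻³ Z_n({2}ᵃ)`** (Tannery).

No new named facts; two auxiliary real-valued definitions (`tailTrunc`, `tailSum`).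

## References

* [LaiLupuOrr2026] L. Lai, C. Lupu, D. Orr, *Elementary proofs of Zagier's formula for multiple zeta
  values and its odd variant*, Proc. AMS 154 (2026), 11–24 (arXiv:2201.09262), Lemma 3.1, Thm 3.2.
* [Zagier2012] D. Zagier, *Evaluation of the multiple zeta values ζ(2,…,2,3,2,…,2)*, Ann. of Math.
  175 (2012), 977–1000, Theorem 1.
* [Brown2012] F. Brown, *Mixed Tate motives over ℤ*, Ann. of Math. 175 (2012), 949–976, Theorem 4.1.
-/

noncomputable section

open Filter Set Real
open scoped Topology BigOperators Nat

namespace Literature.NumberTheory.Transcendental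

namespace MZV

/-! ### Finite tails `tailTrunc b N n = ∑_{N > m₁ > ⋯ > m_b > n} ∏ mⱼ⁻²` -/

/-- The truncated tail sums `∑_{N > m₁ > ⋯ > m_b > n} m₁⁻² ⋯ m_b⁻²`, by the recursion on the largest
entry `m₁ = m ∈ [n+1, N)`. [cite: LaiLupuOrr2026, Lemma 3.1] -/
def tailTrunc : ℕ → ℕ → ℕ → ℝ
  | 0, _, _ => 1
  | b + 1, N, n => ∑ m ∈ Finset.Ico (n + 1) N, ((m : ℝ) ^ 2)⁻¹ * tailTrunc b m n

/-- `tailTrunc 0 N n = 1`. [folklore] -/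
@[simp] theorem tailTrunc_zero (N n : ℕ) : tailTrunc 0 N n = 1 := by simp [tailTrunc]

/-- The defining recursion of `tailTrunc (b+1)`. [folklore] -/
theorem tailTrunc_succ (b N n : ℕ) :
    tailTrunc (b + 1) N n = ∑ m ∈ Finset.Ico (n + 1) N, ((m : ℝ) ^ 2)⁻¹ * tailTrunc b m n := by
  rw [tailTrunc]

/-- `tailTrunc b N n ≥ 0`. [folklore] -/
theorem tailTrunc_nonneg : ∀ b N n, 0 ≤ tailTrunc b N n
  | 0, N, n => by simp
  | b + 1, N, n => by
      rw [tailTrunc_succ]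
      exact Finset.sum_nonneg fun m _ =>
        mul_nonneg (inv_nonneg.2 (sq_nonneg _)) (tailTrunc_nonneg b m n)

/-- `∑_{n < m < N} m⁻² ≤ 2` (Mathlib's `sum_Ioo_inv_sq_le`). [folklore] -/
theorem sum_Ico_succ_inv_sq_le_two (n N : ℕ) : ∑ m ∈ Finset.Ico (n + 1) N, ((m : ℝ) ^ 2)⁻¹ ≤ 2 := by
  have h := sum_Ioo_inv_sq_le (α := ℝ) n N
  rw [Finset.Ico_add_one_left_eq_Ioo]
  refine h.trans ?_
  rw [div_le_iff₀ (by positivity)]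
  have : (0 : ℝ) ≤ n := Nat.cast_nonneg n
  linarith

/-- The crude bound `tailTrunc b N n ≤ 2ᵇ`. [folklore] -/
theorem tailTrunc_le : ∀ b N n, tailTrunc b N n ≤ 2 ^ b
  | 0, N, n => by simp
  | b + 1, N, n => by
      rw [tailTrunc_succ, pow_succ]
      calc ∑ m ∈ Finset.Ico (n + 1) N, ((m : ℝ) ^ 2)⁻¹ * tailTrunc b m n
          ≤ ∑ m ∈ Finset.Ico (n + 1) N, ((m : ℝ) ^ 2)⁻¹ * 2 ^ b :=
            Finset.sum_le_sum fun m _ =>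
              mul_le_mul_of_nonneg_left (tailTrunc_le b m n) (inv_nonneg.2 (sq_nonneg _))
        _ = (∑ m ∈ Finset.Ico (n + 1) N, ((m : ℝ) ^ 2)⁻¹) * 2 ^ b := (Finset.sum_mul _ _ _).symm
        _ ≤ 2 * 2 ^ b := mul_le_mul_of_nonneg_right (sum_Ico_succ_inv_sq_le_two n N) (by positivity)
        _ = 2 ^ b * 2 := mul_comm _ _

/-- No room: `tailTrunc (b+1) N n = 0` if `N ≤ n + 1`. [folklore] -/
theorem tailTrunc_succ_of_le {b N n : ℕ} (h : N ≤ n + 1) : tailTrunc (b + 1) N n = 0 := by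
  rw [tailTrunc_succ, Finset.Ico_eq_empty_of_le h, Finset.sum_empty]

/-- Splitting off the SMALLEST entry: for `n + 1 < m`,
`tailTrunc (b+1) m n = tailTrunc (b+1) m (n+1) + (n+1)⁻² tailTrunc b m (n+1)`. [folklore] -/
theorem tailTrunc_succ_split : ∀ (b : ℕ) {m n : ℕ}, n + 1 < m →
    tailTrunc (b + 1) m n =
      tailTrunc (b + 1) m (n + 1) + (((n : ℝ) + 1) ^ 2)⁻¹ * tailTrunc b m (n + 1)
  | 0, m, n, h => by
      rw [tailTrunc_succ, tailTrunc_succ, Finset.sum_eq_sum_Ico_succ_bot h]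
      push_cast
      simp only [tailTrunc_zero, mul_one]
      ring
  | b + 1, m, n, h => by
      rw [tailTrunc_succ (b + 1) m n, Finset.sum_eq_sum_Ico_succ_bot h,
        tailTrunc_succ_of_le (le_refl (n + 1)), mul_zero, zero_add]
      have hIH : ∀ k ∈ Finset.Ico (n + 1 + 1) m, ((k : ℝ) ^ 2)⁻¹ * tailTrunc (b + 1) k n =
          ((k : ℝ) ^ 2)⁻¹ * tailTrunc (b + 1) k (n + 1) +
            (((n : ℝ) + 1) ^ 2)⁻¹ * (((k : ℝ) ^ 2)⁻¹ * tailTrunc b k (n + 1)) := by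
        intro k hk
        rw [Finset.mem_Ico] at hk
        rw [tailTrunc_succ_split b (by omega : n + 1 < k)]
        ring
      rw [Finset.sum_congr rfl hIH, Finset.sum_add_distrib, ← Finset.mul_sum, ← tailTrunc_succ,
        ← tailTrunc_succ]

/-- At `n = 0` the tails are the truncated multiple zeta sums: `tailTrunc b N 0 = Z_N({2}ᵇ)`.
[folklore] -/
theorem tailTrunc_zero_right : ∀ b N, tailTrunc b N 0 = mzvTrunc (List.replicate b 2) N
  | 0, N => by simp
  | b + 1, N => by
      rw [tailTrunc_succ, List.replicate_succ, mzvTrunc_cons]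
      exact Finset.sum_congr rfl fun m _ => by rw [tailTrunc_zero_right b m]

/-! ### The tails `E_b(n)` as series -/

/-- The tail sums `E_b(n) = ∑_{m₁ > ⋯ > m_b > n} m₁⁻² ⋯ m_b⁻²` (`E₀ = 1`), as the series over the
largest entry `m₁ = n + 1 + k`: `E_{b+1}(n) = ∑_k (n+1+k)⁻² · tailTrunc b (n+1+k) n`
(Lai–Lupu–Orr write `∑_{n < m₁ < ⋯ < m_b} 1/(m₁² ⋯ m_b²)`). [cite: LaiLupuOrr2026, Lemma 3.1] -/
def tailSum : ℕ → ℕ → ℝ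
  | 0, _ => 1
  | b + 1, n => ∑' k : ℕ, (((n + 1 + k : ℕ) : ℝ) ^ 2)⁻¹ * tailTrunc b (n + 1 + k) n

/-- `E₀(n) = 1`. [folklore] -/
@[simp] theorem tailSum_zero (n : ℕ) : tailSum 0 n = 1 := by simp [tailSum]

/-- The defining series of `E_{b+1}(n)`. [folklore] -/
theorem tailSum_succ (b n : ℕ) :
    tailSum (b + 1) n = ∑' k : ℕ, (((n + 1 + k : ℕ) : ℝ) ^ 2)⁻¹ * tailTrunc b (n + 1 + k) n := by
  rw [tailSum]

/-- `∑_k (k+1)⁻²` is summable. [folklore] -/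
theorem summable_inv_succ_sq : Summable fun k : ℕ => (((k : ℝ) + 1) ^ 2)⁻¹ := by
  have h := Real.summable_nat_pow_inv.mpr (by norm_num : 1 < 2)
  simpa using (summable_nat_add_iff 1).mpr h

/-- The terms of the series of `E_{b+1}(n)` are dominated by `2ᵇ (k+1)⁻²`. [folklore] -/
theorem tailSum_term_le (b n k : ℕ) :
    |(((n + 1 + k : ℕ) : ℝ) ^ 2)⁻¹ * tailTrunc b (n + 1 + k) n| ≤ 2 ^ b * (((k : ℝ) + 1) ^ 2)⁻¹ := by
  rw [abs_of_nonneg (mul_nonneg (inv_nonneg.2 (sq_nonneg _)) (tailTrunc_nonneg _ _ _)), mul_comm]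
  refine mul_le_mul (tailTrunc_le b _ n) ?_ (inv_nonneg.2 (sq_nonneg _)) (by positivity)
  refine inv_anti₀ (by positivity) ?_
  push_cast
  nlinarith [Nat.cast_nonneg (α := ℝ) n, Nat.cast_nonneg (α := ℝ) k]

/-- The series of `E_{b+1}(n)` is summable. [folklore] -/
theorem summable_tailSum_term (b n : ℕ) :
    Summable fun k : ℕ => (((n + 1 + k : ℕ) : ℝ) ^ 2)⁻¹ * tailTrunc b (n + 1 + k) n :=
  Summable.of_norm_bounded (summable_inv_succ_sq.mul_left (2 ^ b))
    fun k => by rw [Real.norm_eq_abs]; exact tailSum_term_le b n k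

/-- `HasSum` form of the series of `E_{b+1}(n)`. [folklore] -/
theorem hasSum_tailSum_succ (b n : ℕ) :
    HasSum (fun k : ℕ => (((n + 1 + k : ℕ) : ℝ) ^ 2)⁻¹ * tailTrunc b (n + 1 + k) n)
      (tailSum (b + 1) n) := by
  rw [tailSum_succ]; exact (summable_tailSum_term b n).hasSum

/-- `E_b(n) ≥ 0`. [folklore] -/
theorem tailSum_nonneg : ∀ b n, 0 ≤ tailSum b n
  | 0, n => by simp
  | b + 1, n => by
      rw [tailSum_succ]
      exact tsum_nonneg fun k => mul_nonneg (inv_nonneg.2 (sq_nonneg _)) (tailTrunc_nonneg _ _ _)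

/-- **The finite tails converge to the tails**: `tailTrunc b N n → E_b(n)` as `N → ∞`. [folklore] -/
theorem tendsto_tailTrunc : ∀ b n, Tendsto (fun N => tailTrunc b N n) atTop (𝓝 (tailSum b n))
  | 0, n => by simp
  | b + 1, n => by
      have h := (hasSum_tailSum_succ b n).tendsto_sum_nat.comp (tendsto_sub_atTop_nat (n + 1))
      refine h.congr fun N => ?_
      simp only [Function.comp_apply]
      rw [tailTrunc_succ, Finset.sum_Ico_eq_sum_range]

/-- **The recursion of the tails in `n`**: `E_{b+1}(n) = E_{b+1}(n+1) + (n+1)⁻² E_b(n+1)`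
(splitting off the smallest entry `m_{b+1} = n + 1`). [cite: LaiLupuOrr2026, Lemma 3.1] -/
theorem tailSum_succ_eq (b n : ℕ) :
    tailSum (b + 1) n = tailSum (b + 1) (n + 1) + (((n : ℝ) + 1) ^ 2)⁻¹ * tailSum b (n + 1) := by
  rw [tailSum_succ, (summable_tailSum_term b n).tsum_eq_zero_add]
  have hcast : ∀ k : ℕ, ((n + 1 + (k + 1) : ℕ) : ℝ) = ((n + 1 + 1 + k : ℕ) : ℝ) := by
    intro k; push_cast; ring
  have hidx : ∀ k : ℕ, n + 1 + (k + 1) = n + 1 + 1 + k := by intro k; ring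
  cases b with
  | zero =>
      simp only [tailTrunc_zero, mul_one, tailSum_zero, add_zero]
      rw [add_comm, tailSum_succ]
      simp only [tailTrunc_zero, mul_one]
      congr 1
      · refine tsum_congr fun k => ?_
        rw [hcast k]
      · push_cast; ring
  | succ b =>
      rw [tailTrunc_succ_of_le (by omega), mul_zero, zero_add]
      have hsplit : ∀ k : ℕ, (((n + 1 + (k + 1) : ℕ) : ℝ) ^ 2)⁻¹ * tailTrunc (b + 1) (n + 1 + (k + 1)) n
          = (((n + 1 + 1 + k : ℕ) : ℝ) ^ 2)⁻¹ * tailTrunc (b + 1) (n + 1 + 1 + k) (n + 1) +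
            (((n : ℝ) + 1) ^ 2)⁻¹ *
              ((((n + 1 + 1 + k : ℕ) : ℝ) ^ 2)⁻¹ * tailTrunc b (n + 1 + 1 + k) (n + 1)) := by
        intro k
        rw [hcast k, hidx k, tailTrunc_succ_split b (by omega : n + 1 < n + 1 + 1 + k)]
        ring
      rw [tsum_congr hsplit, (summable_tailSum_term (b + 1) (n + 1)).tsum_add
        ((summable_tailSum_term b (n + 1)).mul_left _), tsum_mul_left, ← tailSum_succ,
        ← tailSum_succ]

/-- `E_b(0) = ζ({2}ᵇ)` (the tree's `multipleZeta (replicate b 2)`). [folklore] -/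
theorem tailSum_zero_right (b : ℕ) : tailSum b 0 = multipleZeta (List.replicate b 2) := by
  have h1 := tendsto_tailTrunc b 0
  simp_rw [tailTrunc_zero_right] at h1
  exact tendsto_nhds_unique h1 (tendsto_mzvTrunc (isAdmissible_replicate_two b))

/-- `E_b(0) = π²ᵇ/(2b+1)!` (Hoffman–Zagier, `multipleZeta_replicate_two`).
[cite: LaiLupuOrr2026, Lemma 3.1] -/
theorem tailSum_zero_right_eq (b : ℕ) : tailSum b 0 = π ^ (2 * b) / (2 * b + 1)! := by
  rw [tailSum_zero_right, multipleZeta_replicate_two]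

/-- The crude bound `E_b(n) ≤ 2ᵇ` (from `∑ (k+1)⁻² = π²/6 ≤ 2`). [folklore] -/
theorem tailSum_le : ∀ b n, tailSum b n ≤ 2 ^ b
  | 0, n => by simp
  | b + 1, n => by
      have hz : HasSum (fun k : ℕ => (((k : ℝ) + 1) ^ 2)⁻¹) (π ^ 2 / 6) := by
        have h := hasSum_zeta_two
        rw [← hasSum_nat_add_iff' 1] at h
        simpa using h
      have hle : tailSum (b + 1) n ≤ 2 ^ b * (π ^ 2 / 6) := by
        rw [← hz.tsum_eq, ← tsum_mul_left]
        refine (hasSum_tailSum_succ b n).summable.tsum_le_tsum (fun k => ?_)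
          (hz.summable.mul_left _)
        exact (le_abs_self _).trans (tailSum_term_le b n k)
      have hπ : π ^ 2 / 6 ≤ 2 := by
        have := Real.pi_lt_d2; nlinarith [Real.pi_pos]
      calc tailSum (b + 1) n ≤ 2 ^ b * (π ^ 2 / 6) := hle
        _ ≤ 2 ^ b * 2 := mul_le_mul_of_nonneg_left hπ (by positivity)
        _ = 2 ^ (b + 1) := by rw [pow_succ]

/-! ### The `arcsin` coefficients are truncated multiple zeta sums -/

/-- `e_a(n) = Z_n({2}ᵃ)`: the nested sums of the `arcsin` power series are the truncated multiple
zeta sums `∑_{n > n₁ > ⋯ > n_a ≥ 1} ∏ nᵢ⁻²`. [cite: LaiLupuOrr2026, §3 eq. (2)] -/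
theorem arcsinNestedSum_eq_mzvTrunc : ∀ a n,
    Literature.Analysis.SpecialFunctions.arcsinNestedSum a n = mzvTrunc (List.replicate a 2) n
  | 0, n => by simp
  | a + 1, n => by
      rw [Literature.Analysis.SpecialFunctions.arcsinNestedSum_succ, List.replicate_succ,
        mzvTrunc_cons]
      exact Finset.sum_congr rfl fun m _ => by rw [arcsinNestedSum_eq_mzvTrunc a m]

/-! ### Unfolding `Z_N(2ᵇ ++ c :: u)` through the tails -/

/-- `Z_N(2, …, 2, c, u) = ∑_{1 ≤ n < N} tailTrunc b N n · n⁻ᶜ · Z_n(u)`: peel the `b` leading twos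
(largest indices) with Hoffman's recursion and move the position `n` of the letter `c` outermost.
[folklore] -/
theorem mzvTrunc_replicate_two_append : ∀ (b : ℕ) (c : ℕ) (u : List ℕ) (N : ℕ),
    mzvTrunc (List.replicate b 2 ++ c :: u) N =
      ∑ n ∈ Finset.Ico 1 N, tailTrunc b N n * ((((n : ℝ) ^ c)⁻¹) * mzvTrunc u n)
  | 0, c, u, N => by
      simp only [List.replicate_zero, List.nil_append, tailTrunc_zero, one_mul]
      exact mzvTrunc_cons c u N
  | b + 1, c, u, N => by
      rw [List.replicate_succ, List.cons_append, mzvTrunc_cons]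
      simp_rw [mzvTrunc_replicate_two_append b c u, Finset.mul_sum, tailTrunc_succ, Finset.sum_mul,
        mul_assoc]
      exact Finset.sum_comm' fun m n => by simp only [Finset.mem_Ico]; omega

/-! ### The series for `ζ(2ᵇ 3 2ᵃ)` -/

/-- **`ζ(2ᵇ 3 2ᵃ) = ∑ₙ E_b(n) · n⁻³ · Z_n({2}ᵃ)`** — the last display of the proof of
[LaiLupuOrr2026, Theorem 3.2] (`∑ₙ n⁻³ (∑_{n₁<⋯<n_a<n} ∏nᵢ⁻²)(∑_{n<m₁<⋯<m_b} ∏mⱼ⁻²) = H(a,b)`)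
in the tree's decreasing convention `H(a,b) = multipleZeta (replicate b 2 ++ 3 :: replicate a 2)`;
from `mzvTrunc_replicate_two_append` by letting `N → ∞` (Tannery's theorem, the summands being
dominated by `2ᵃ⁺ᵇ n⁻³`). [cite: LaiLupuOrr2026, Theorem 3.2] -/
theorem multipleZeta_twos_three_twos_eq_tsum (a b : ℕ) :
    multipleZeta (List.replicate b 2 ++ 3 :: List.replicate a 2) =
      ∑' n : ℕ, tailSum b n * ((((n : ℝ) ^ 3)⁻¹) * mzvTrunc (List.replicate a 2) n) := by
  set s := List.replicate b 2 ++ 3 :: List.replicate a 2 with hs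
  have hadm : IsAdmissible s := (isHoffman_twos_three_twos a b).isAdmissible
  -- the truncations as sums over all of ℕ
  set f : ℕ → ℕ → ℝ := fun N n =>
    if n < N then tailTrunc b N n * ((((n : ℝ) ^ 3)⁻¹) * mzvTrunc (List.replicate a 2) n) else 0
    with hf
  have hfN : ∀ N, ∑' n, f N n = mzvTrunc s N := by
    intro N
    rw [tsum_eq_sum (s := Finset.range N) (fun n hn => by
      rw [Finset.mem_range] at hn; simp [hf, hn])]
    rw [hs, mzvTrunc_replicate_two_append b 3 (List.replicate a 2) N, Finset.range_eq_Ico]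
    rcases Nat.eq_zero_or_pos N with rfl | hN
    · simp
    · rw [Finset.sum_eq_sum_Ico_succ_bot hN]
      have h0 : f N 0 = 0 := by simp [hf]
      rw [h0, zero_add]
      refine Finset.sum_congr rfl fun n hn => ?_
      rw [Finset.mem_Ico] at hn
      simp [hf, hn.2]
  -- Tannery
  have hbound : Summable fun n : ℕ => (2 : ℝ) ^ b * ((((n : ℝ) ^ 3)⁻¹) * 2 ^ a) :=
    ((Real.summable_nat_pow_inv.mpr (by norm_num : 1 < 3)).mul_right _).mul_left _
  have hlim : Tendsto (fun N => ∑' n, f N n) atTop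
      (𝓝 (∑' n : ℕ, tailSum b n * ((((n : ℝ) ^ 3)⁻¹) * mzvTrunc (List.replicate a 2) n))) := by
    refine tendsto_tsum_of_dominated_convergence hbound (fun n => ?_) ?_
    · have h := ((tendsto_tailTrunc b n).mul_const
        ((((n : ℝ) ^ 3)⁻¹) * mzvTrunc (List.replicate a 2) n))
      refine h.congr' ?_
      filter_upwards [eventually_gt_atTop n] with N hN
      simp [hf, hN]
    · refine Eventually.of_forall fun N n => ?_
      simp only [hf]
      split_ifs with h
      · rw [Real.norm_eq_abs, abs_of_nonneg (mul_nonneg (tailTrunc_nonneg _ _ _)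
          (mul_nonneg (inv_nonneg.2 (by positivity)) (mzvTrunc_nonneg _ _)))]
        exact mul_le_mul (tailTrunc_le b N n) (mul_le_mul_of_nonneg_left
          (mzvTrunc_replicate_two_le a n) (inv_nonneg.2 (by positivity))) (mul_nonneg
          (inv_nonneg.2 (by positivity)) (mzvTrunc_nonneg _ _)) (by positivity)
      · rw [norm_zero]; positivity
  simp_rw [hfN] at hlim
  exact tendsto_nhds_unique (tendsto_mzvTrunc hadm) hlim

end MZV

end Literature.NumberTheory.Transcendental
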